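import Summits.Ventures.CertifiedManyBodySolver.Rows.CorrWindowCertKernelChainQuotAdjFastNBox
import Summits.Ventures.CertifiedManyBodySolver.Rows.CorrWindowCertKernelHintCode
import HarnessLib

/-!
# The chain step on LETTER CODES (part 5): hint CODES decoded on ℕ and class representatives READ AS CODES by name

Parts 1–4 (`Rows/CorrWindowCertKernelChainQuotAdjFastN{,Key,Stages,Box}.lean`) take the decoded hint list `H = hintsOfCodes Dr reps HC`
(`Rows/CorrWindowCertKernelHintCode.lean`) as the chain file states it: per hint the kernel then builds a `Fin 8`, two `ℤ` shifts, walks the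
`PTree` with `Decidable` tests, decodes every letter of the class representative to an `Orb (Fin Nβ)` (`reps = repsE.map (mapMono dec)` in
the emitted `Reps` module) and re-encodes it with `encL`. When the chain file can say BY NAME that its `reps` is a coded table read through a
decoder of the standard shape (`hreps : reps = repsE.map (mapMono (decN Nβ))`, provable by `rfl` for the tier-P emitter's `Reps.lean`), the
code step reads the table directly: `decN`, `normC` (`encL ∘ decN` on codes), `getB?`/`lookupB` (the `PTree` read with `Bool` tests,
`lookupB_eq`), `hintRowsNR` (rows straight from the codes), **`stepEQNR`**, `hintRowsNR_eq`, **`stepEQNR_eq`** and the entry point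
**`stepEQNR_kernel hD hreps (h : (C' == stepEQNR r R vmax B C T Dr repsE HC) = true) : C' = stepEQA D B C T (hintsOfCodes Dr reps HC)`** —
chain-file proof term `stepEQNR_kernel 6 13 7 rfl rfl (by decide +kernel)`, statement unchanged.

HONEST FRAMING (xx1): Lean plumbing towards «tier P» — a PROOF-TERM-only speed-up of the kernel replay of chain steps; every
`step_s` STATEMENT, accumulator literal, census/EQUAL artefact, `ChainQAOK`/closer stays byte-identical. Nothing of record moves; no
certificate is evaluated here; no claim node is discharged; CONTROL/CALIBRATION context; silent on the presence of superconductivity;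
not a `T_c` or phase sentence; nothing about any material; no summit statement is proved by this file. Cell `hubbard-obs` ×
`hubbard-downfold` (D-0154 (1)(C) La214), seat hubbard-cov-la214-box-2 g6 (`prover-hubbard-cov-la214-box-2-g6-0`), zero compute.

References: C. Jansson, D. Chaykin, C. Keil, SIAM J. Numer. Anal. 46 (2008) 180 [JanssonChaykinKeil2008]; X. Han, arXiv:2006.06002 §3
[Han2020Bootstrap]; C. Okasaki, *Purely Functional Data Structures* (CUP 1998) §9.2 [Okasaki1998].
-/

namespace Summit.Ventures.CertifiedManyBodySolver

namespace CARPolyWindow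

open Summit.Ventures.CertifiedQuantumChemistry Summit.Ventures.CertifiedQuantumChemistry.CARPoly
open Literature.MathematicalPhysics.QuantumLattice Literature.MathematicalPhysics.QuantumLattice.HubbardWave0

/-! ## §1 Coded class tables and the `Bool` tree read -/

section Codes

open BoxGeom

/-- The standard letter decoder of a coded class table: code `e = 2j + σ` ↦ `orb j σ` (indices read modulo the range, as `Fin.ofNat`
does; definitionally the tier-P emitter's `dec`). [folklore] -/
def decN (N : ℕ) (hN : 0 < N) (e : ℕ) : Orb (Fin N) := orb ⟨(e / 2) % N, Nat.mod_lt _ hN⟩ ⟨(e % 2) % 2, Nat.mod_lt _ (by omega)⟩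

/-- `encL ∘ decN` on codes. [folklore] -/
def normC (N : ℕ) (e : ℕ) : ℕ := 2 * (e / 2 % N) + e % 2 % 2

/-- `normC` IS `encL ∘ decN`. [folklore] -/
theorem encL_decN (N : ℕ) (hN : 0 < N) (e : ℕ) : SOSDual.encL (decN N hN e) = normC N e := rfl

/-- `PTree.get?` with `Bool` tests. [cite: Okasaki1998, §9.2] -/
def getB? {β : Type*} : PTree β → ℕ → ℕ → Option β
  | .nil, _, _ => none
  | .leaf b, _, i => bif Nat.beq i 0 then some b else none
  | .node _ _, 0, _ => none
  | .node t₁ t₂, D + 1, i => bif Nat.blt i (2 ^ D) then getB? t₁ D i else getB? t₂ D (i - 2 ^ D)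

/-- `getB?` IS `PTree.get?`. [folklore] -/
theorem getB?_eq {β : Type*} : ∀ (t : PTree β) (D i : ℕ), getB? t D i = t.get? D i
  | .nil, _, _ => rfl
  | .leaf b, D, i => by
    rw [getB?, PTree.get?]
    have e : Nat.beq i 0 = decide (i = 0) := by rw [Bool.eq_iff_iff, Nat.beq_eq, decide_eq_true_iff]
    rw [e]; by_cases h : i = 0 <;> simp [h]
  | .node _ _, 0, _ => rfl
  | .node t₁ t₂, D + 1, i => by
    have hblt : ∀ a b : ℕ, Nat.blt a b = decide (a < b) := fun a b => by rw [Bool.eq_iff_iff, Nat.blt_eq, decide_eq_true_iff]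
    rw [getB?, PTree.get?, getB?_eq t₁, getB?_eq t₂, hblt]
    by_cases h : i < 2 ^ D <;> simp [h]

/-- `PTree.lookup` with `Bool` tests. [cite: Okasaki1998, §9.2] -/
def lookupB {β : Type*} (D : ℕ) (t : PTree β) (l : List β) (i : ℕ) (d : β) : β :=
  bif Nat.blt i (2 ^ D) then (getB? t D i).getD d else l.getD i d

/-- `lookupB` IS `PTree.lookup`. [folklore] -/
theorem lookupB_eq {β : Type*} (D : ℕ) (t : PTree β) (l : List β) (i : ℕ) (d : β) : lookupB D t l i d = PTree.lookup D t l i d := by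
  have hblt : ∀ a b : ℕ, Nat.blt a b = decide (a < b) := fun a b => by rw [Bool.eq_iff_iff, Nat.blt_eq, decide_eq_true_iff]
  rw [lookupB, PTree.lookup, getB?_eq, hblt]
  by_cases h : i < 2 ^ D <;> simp [h]

variable (r R vmax : ℕ)

/-- Hint rows STRAIGHT FROM THE CODES: `code = ((cls·16 + (v₁+8))·16 + (v₂+8))·8 + γ`, licence `|v|∞ ≤ vmax` tested on `u = v + 8` in ℕ,
class representative read from the coded table through the `Bool` tree and normalised by `normC`. [cite: Han2020Bootstrap, §3] -/
def hintRowsNR (B Dr : ℕ) (repsE : List (List ℕ × List ℕ)) (HC : List ℕ) : List RowN :=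
  let tE := (PTree.build Dr repsE).1
  HC.filterMap fun code =>
    let u1 := code / 128 % 16
    let u2 := code / 8 % 16
    bif Nat.ble (8 - vmax) u1 && Nat.ble u1 (8 + vmax) && Nat.ble (8 - vmax) u2 && Nat.ble u2 (8 + vmax) then
      let μE := lookupB Dr tE repsE (code / 2048) ([], [])
      let μN : MonoN := (μE.1.map (normC (boxN r)), μE.2.map (normC (boxN r)))
      let w1 := u1 + vmax - 8
      let w2 := u2 + vmax - 8
      let g := gqK (side r) (side R) (w1 + (R - r) - vmax) (w2 + (R - r) - vmax) (R + r + w1 - vmax) (R + r + w2 - vmax) (code % 8)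
      match monoNFN ((μN.1.map g), (μN.2.map g)) with
      | some ns => some (keyN B ns.1, (ns.2, μN))
      | none => none
    else none

/-- **THE CODE STEP READING HINT CODES AND A CODED CLASS TABLE.** [cite: JanssonChaykinKeil2008, §3] [cite: Han2020Bootstrap, §3] -/
def stepEQNR (B : ℕ) (C : SOSDual.EncPoly) (T : Terms (Orb (Fin (boxN R)))) (Dr : ℕ) (repsE : List (List ℕ × List ℕ)) (HC : List ℕ) :
    SOSDual.EncPoly :=
  if r + vmax ≤ R ∧ 2 * boxN R + 1 ≤ B then
    let P0 := collectK (termsToPolyKN SOSDual.encL B T)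
    let A := annotateN P0 (sortByKeyB (hintRowsNR r R vmax B Dr repsE HC))
    let P1 := collectK (termsToPolyKM B (quotOutNM r R B A))
    SOSDual.mergeE B C (toEnc (collectK (termsToPolyKM B (adjOutNM B P1))))
  else stepEQA (boxQuot r R vmax) B C T
    (hintsOfCodes Dr (repsE.map (mapMono (decN (boxN r) (boxN_pos r)))) HC)

/-! ## §2 The coded rows ARE the rows of the decoded hints -/

/-- One hint code, both sides. [cite: Han2020Bootstrap, §3] -/
theorem hintRowNR_eq (B Dr : ℕ) (repsE : List (List ℕ × List ℕ)) (code : ℕ) :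
    (let u1 := code / 128 % 16
     let u2 := code / 8 % 16
     bif Nat.ble (8 - vmax) u1 && Nat.ble u1 (8 + vmax) && Nat.ble (8 - vmax) u2 && Nat.ble u2 (8 + vmax) then
      let μE := lookupB Dr (PTree.build Dr repsE).1 repsE (code / 2048) ([], [])
      let μN : MonoN := (μE.1.map (normC (boxN r)), μE.2.map (normC (boxN r)))
      let w1 := u1 + vmax - 8
      let w2 := u2 + vmax - 8
      let g := gqK (side r) (side R) (w1 + (R - r) - vmax) (w2 + (R - r) - vmax) (R + r + w1 - vmax) (R + r + w2 - vmax) (code % 8)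
      match monoNFN ((μN.1.map g), (μN.2.map g)) with
      | some ns => some (keyN B ns.1, (ns.2, μN))
      | none => none
     else none) =
    (let h := hintOfCode Dr (PTree.build Dr (repsE.map (mapMono (decN (boxN r) (boxN_pos r))))).1
        (repsE.map (mapMono (decN (boxN r) (boxN_pos r)))) code
     bif boxOk vmax h.γ h.v then
      let w1 := (h.v.1 + (vmax : ℤ)).toNat
      let w2 := (h.v.2 + (vmax : ℤ)).toNat
      let g := gqK (side r) (side R) (w1 + (R - r) - vmax) (w2 + (R - r) - vmax) (R + r + w1 - vmax) (R + r + w2 - vmax) h.γ.val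
      match monoNFN (((encM SOSDual.encL h.μ).1.map g), ((encM SOSDual.encL h.μ).2.map g)) with
      | some ns => some (keyN B ns.1, (ns.2, encM SOSDual.encL h.μ))
      | none => none
     else none) := by
  dsimp only
  -- the licence test
  have hok : (Nat.ble (8 - vmax) (code / 128 % 16) && Nat.ble (code / 128 % 16) (8 + vmax) && Nat.ble (8 - vmax) (code / 8 % 16) &&
      Nat.ble (code / 8 % 16) (8 + vmax)) = boxOk vmax (hintOfCode Dr (PTree.build Dr (repsE.map (mapMono (decN (boxN r) (boxN_pos r))))).1
        (repsE.map (mapMono (decN (boxN r) (boxN_pos r)))) code).γ (hintOfCode Dr (PTree.build Dr (repsE.map (mapMono (decN (boxN r) (boxN_pos r))))).1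
        (repsE.map (mapMono (decN (boxN r) (boxN_pos r)))) code).v := by
    rw [boxOk, hintOfCode]
    dsimp only
    rw [Bool.eq_iff_iff]
    simp only [Bool.and_eq_true, Nat.ble_eq, decide_eq_true_iff]
    omega
  rw [hok]
  cases hb : boxOk vmax (hintOfCode Dr (PTree.build Dr (repsE.map (mapMono (decN (boxN r) (boxN_pos r))))).1
      (repsE.map (mapMono (decN (boxN r) (boxN_pos r)))) code).γ (hintOfCode Dr (PTree.build Dr (repsE.map (mapMono (decN (boxN r) (boxN_pos r))))).1
      (repsE.map (mapMono (decN (boxN r) (boxN_pos r)))) code).v with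
  | false => rfl
  | true =>
    simp only [cond_true]
    -- the class representative by name
    have hμ : (hintOfCode Dr (PTree.build Dr (repsE.map (mapMono (decN (boxN r) (boxN_pos r))))).1
        (repsE.map (mapMono (decN (boxN r) (boxN_pos r)))) code).μ =
        mapMono (decN (boxN r) (boxN_pos r)) (lookupB Dr (PTree.build Dr repsE).1 repsE (code / 2048) ([], [])) := by
      rw [hintOfCode]
      dsimp only
      rw [PTree.lookup_build, lookupB_eq, PTree.lookup_build,
        show (([], []) : CARPoly.Mono (Orb (Fin (boxN r)))) = mapMono (decN (boxN r) (boxN_pos r)) ([], []) from rfl]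
      simp only [List.getD_eq_getElem?_getD, List.getElem?_map, Option.getD_map]
    have hμN : encM SOSDual.encL (hintOfCode Dr (PTree.build Dr (repsE.map (mapMono (decN (boxN r) (boxN_pos r))))).1
        (repsE.map (mapMono (decN (boxN r) (boxN_pos r)))) code).μ =
        ((lookupB Dr (PTree.build Dr repsE).1 repsE (code / 2048) ([], [])).1.map (normC (boxN r)),
         (lookupB Dr (PTree.build Dr repsE).1 repsE (code / 2048) ([], [])).2.map (normC (boxN r))) := by
      rw [hμ]; simp only [encM, mapMono, List.map_map, Function.comp_def, encL_decN]
    -- shifts and the `D₄` code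
    have hv : boxOk vmax (hintOfCode Dr (PTree.build Dr (repsE.map (mapMono (decN (boxN r) (boxN_pos r))))).1
        (repsE.map (mapMono (decN (boxN r) (boxN_pos r)))) code).γ (hintOfCode Dr (PTree.build Dr (repsE.map (mapMono (decN (boxN r) (boxN_pos r))))).1
        (repsE.map (mapMono (decN (boxN r) (boxN_pos r)))) code).v = true := hb
    rw [boxOk, hintOfCode] at hv
    dsimp only at hv
    have hv' := of_decide_eq_true hv
    have hw1 : ((((code / 128 % 16 : ℕ) : ℤ) - 8) + (vmax : ℤ)).toNat = code / 128 % 16 + vmax - 8 := by omega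
    have hw2 : ((((code / 8 % 16 : ℕ) : ℤ) - 8) + (vmax : ℤ)).toNat = code / 8 % 16 + vmax - 8 := by omega
    have hγ : (hintOfCode Dr (PTree.build Dr (repsE.map (mapMono (decN (boxN r) (boxN_pos r))))).1
        (repsE.map (mapMono (decN (boxN r) (boxN_pos r)))) code).γ.val = code % 8 := by
      rw [hintOfCode]; exact Nat.mod_mod_of_dvd _ (dvd_refl 8)
    rw [hμN, hγ]
    rw [show (hintOfCode Dr (PTree.build Dr (repsE.map (mapMono (decN (boxN r) (boxN_pos r))))).1
        (repsE.map (mapMono (decN (boxN r) (boxN_pos r)))) code).v = ((((code / 128 % 16 : ℕ) : ℤ) - 8), (((code / 8 % 16 : ℕ) : ℤ) - 8))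
        from rfl]
    dsimp only
    rw [hw1, hw2]

/-- **The coded rows ARE `hintRowsN` of the decoded hints.** [cite: Han2020Bootstrap, §3] -/
theorem hintRowsNR_eq (B Dr : ℕ) (repsE : List (List ℕ × List ℕ)) (HC : List ℕ) :
    hintRowsNR r R vmax B Dr repsE HC = hintRowsN r R vmax B (hintsOfCodes Dr (repsE.map (mapMono (decN (boxN r) (boxN_pos r)))) HC) := by
  rw [hintRowsNR, hintRowsN, hintsOfCodes, List.filterMap_map]
  congr 1
  funext code
  exact hintRowNR_eq r R vmax B Dr repsE code

/-- **THE CODED STEP IS THE CODE STEP on the decoded hints.** [folklore] -/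
theorem stepEQNR_eq_stepEQN (B : ℕ) (C : SOSDual.EncPoly) (T : Terms (Orb (Fin (boxN R)))) (Dr : ℕ) (repsE : List (List ℕ × List ℕ))
    (HC : List ℕ) : stepEQNR r R vmax B C T Dr repsE HC =
      stepEQN r R vmax B C T (hintsOfCodes Dr (repsE.map (mapMono (decN (boxN r) (boxN_pos r)))) HC) := by
  unfold stepEQNR stepEQN
  rw [hintRowsNR_eq]

/-- **THE CODED STEP IS THE STEP** for a class table given by name. [folklore] -/
theorem stepEQNR_eq {reps : List (CARPoly.Mono (Orb (Fin (boxN r))))} {repsE : List (List ℕ × List ℕ)}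
    (hreps : reps = repsE.map (mapMono (decN (boxN r) (boxN_pos r)))) (B : ℕ) (C : SOSDual.EncPoly) (T : Terms (Orb (Fin (boxN R))))
    (Dr : ℕ) (HC : List ℕ) : stepEQNR r R vmax B C T Dr repsE HC = stepEQA (boxQuot r R vmax) B C T (hintsOfCodes Dr reps HC) := by
  rw [stepEQNR_eq_stepEQN, stepEQN_eq, hreps]

/-- **THE CHAIN-FILE ENTRY POINT (coded table by name):**
`theorem step_s : C' = stepEQA D 2048 C T (hintsOfCodes Dr reps HC) := stepEQNR_kernel 6 13 7 rfl rfl (by decide +kernel)`. [folklore] -/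
theorem stepEQNR_kernel {D : QuotData (boxN R) (boxN r)} (hD : D = boxQuot r R vmax)
    {reps : List (CARPoly.Mono (Orb (Fin (boxN r))))} {repsE : List (List ℕ × List ℕ)}
    (hreps : reps = repsE.map (mapMono (decN (boxN r) (boxN_pos r)))) {B : ℕ} {C C' : SOSDual.EncPoly}
    {T : Terms (Orb (Fin (boxN R)))} {Dr : ℕ} {HC : List ℕ} (h : (C' == stepEQNR r R vmax B C T Dr repsE HC) = true) :
    C' = stepEQA D B C T (hintsOfCodes Dr reps HC) := by
  rw [hD]; exact (eq_of_beq h).trans (stepEQNR_eq r R vmax hreps B C T Dr HC)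

end Codes

end CARPolyWindow

end Summit.Ventures.CertifiedManyBodySolver
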